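import Summits.ValiantsHypothesis.ValiantsHypothesis.Theorems.BarrierLeverChowHitsPartitionMinorsRStarvedSpan
import Summits.ValiantsHypothesis.ValiantsHypothesis.Theorems.BarrierLeverChowHitsPartitionMinorsRXStar

/-!
# Route BarrierLever — item `ChowHitsPartitionMinorsR` (stmt-ValiantsHypothesis-21882), STARVED DESIGN IX:
# row ranks, the pivot bijection and the pivot entries of the starved design

Helper file (`--supports stmt-ValiantsHypothesis-21882`; cell valiant-natproofs, rung V4, 𝒟-side; prover seat val-np-p5
gen 31). Closes NO item. Ninth file of the kernel chain for THEOREM A′ of memo MEMO-21882-valnp5-g31.md §3/§5: the rank of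
a thin row (`rowRank`: `∅ 0 < O-singleton 1 < O–O edge 2 < mixed edge 3 < non-edge 4 < K-singleton 5 < K–K edge 6`), the
pivot bijection `pivEquiv` (column `k ↦` the row `w k` if `|w k| ≤ 2`, the matched non-edge if `|w k| = 3`), matched /
unmatched pair rows (`pPoly_pair_matched/unmatched`), the nonzero PIVOTS (`pMat_diag`: `1, −1, 1, 1, 24, −1, 1`) and the
vanishing of unmatched pair rows at mixed columns (`coeff_rr_mul_rr_mixed_eq_zero`). The assembly is `…RStarvedTheoremA`.

WHAT THIS IS NOT: nothing on crux stmt-ValiantsHypothesis-14610 or on `VP` versus `VNP`.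
-/
set_option linter.dupNamespace false

namespace Summit.ValiantsHypothesis.ValiantsHypothesis.Theorems.BarrierLever.ChowStarvedDesign

open Finset MvPolynomial

noncomputable section

variable {h r : ℕ}

/-! ## 1. Thin sets -/

/-- A set of size `≤ 2` is `∅`, a singleton or a pair. -/
theorem thin_cases (U : Finset (Fin h)) (hU : U.card ≤ 2) :
    U = ∅ ∨ (∃ v, U = {v}) ∨ (∃ x y, x ≠ y ∧ U = {x, y}) := by
  rcases Nat.lt_or_ge U.card 1 with h0 | h1
  · exact Or.inl (Finset.card_eq_zero.mp (by omega))
  rcases Nat.lt_or_ge U.card 2 with h1' | h2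
  · obtain ⟨v, hv⟩ := Finset.card_eq_one.mp (show U.card = 1 by omega)
    exact Or.inr (Or.inl ⟨v, hv⟩)
  · obtain ⟨x, y, hxy, hU'⟩ := Finset.card_eq_two.mp (show U.card = 2 by omega)
    exact Or.inr (Or.inr ⟨x, y, hxy, hU'⟩)

section Assembly

variable (w : Fin r → Finset (Fin h)) (O : Finset (Fin h)) (α β : {j : Fin r // (w j).card = 3} → Fin h)
  (u : Fin r → Finset (Fin h))

/-! ## 2. The rank of a row -/

open Classical in
/-- The rank of a thin row: `∅ 0`, O-singleton `1`, O–O column pair `2`, mixed pair `3`, O–O non-column pair `4`,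
K-singleton `5`, K–K pair `6`. -/
def rowRank (U : Finset (Fin h)) : ℕ :=
  if U.card = 0 then 0
  else if U.card = 1 then (if U ⊆ O then 1 else 5)
  else if U ⊆ O then (if ∃ k, w k = U then 2 else 4)
  else if ∃ c ∈ U, c ∈ O then 3 else 6

/-- `rowRank_le` (see the file header). -/
theorem rowRank_le (U : Finset (Fin h)) : rowRank w O U ≤ 6 := by
  unfold rowRank; split_ifs <;> omega

/-- `rowRank_empty` (see the file header). -/
theorem rowRank_empty : rowRank w O (∅ : Finset (Fin h)) = 0 := by
  unfold rowRank; simp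

/-- `rowRank_single_O` (see the file header). -/
theorem rowRank_single_O {v : Fin h} (hv : v ∈ O) : rowRank w O ({v} : Finset (Fin h)) = 1 := by
  unfold rowRank
  rw [if_neg (by simp), if_pos (Finset.card_singleton v), if_pos (Finset.singleton_subset_iff.mpr hv)]

/-- `rowRank_single_K` (see the file header). -/
theorem rowRank_single_K {v : Fin h} (hv : v ∉ O) : rowRank w O ({v} : Finset (Fin h)) = 5 := by
  unfold rowRank
  rw [if_neg (by simp), if_pos (Finset.card_singleton v), if_neg (fun hs => hv (Finset.singleton_subset_iff.mp hs))]

/-- `rowRank_pair_OO_col` (see the file header). -/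
theorem rowRank_pair_OO_col {x y : Fin h} (hxy : x ≠ y) (hx : x ∈ O) (hy : y ∈ O) (hcol : ∃ k, w k = {x, y}) :
    rowRank w O ({x, y} : Finset (Fin h)) = 2 := by
  unfold rowRank
  rw [if_neg (by rw [Finset.card_pair hxy]; omega), if_neg (by rw [Finset.card_pair hxy]; omega),
    if_pos (Finset.insert_subset_iff.mpr ⟨hx, Finset.singleton_subset_iff.mpr hy⟩), if_pos hcol]

/-- `rowRank_pair_OO_ncol` (see the file header). -/
theorem rowRank_pair_OO_ncol {x y : Fin h} (hxy : x ≠ y) (hx : x ∈ O) (hy : y ∈ O) (hcol : ¬ ∃ k, w k = {x, y}) :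
    rowRank w O ({x, y} : Finset (Fin h)) = 4 := by
  unfold rowRank
  rw [if_neg (by rw [Finset.card_pair hxy]; omega), if_neg (by rw [Finset.card_pair hxy]; omega),
    if_pos (Finset.insert_subset_iff.mpr ⟨hx, Finset.singleton_subset_iff.mpr hy⟩), if_neg hcol]

/-- `rowRank_pair_mixed` (see the file header). -/
theorem rowRank_pair_mixed {t a : Fin h} (ht : t ∉ O) (ha : a ∈ O) :
    rowRank w O ({t, a} : Finset (Fin h)) = 3 := by
  have hta : t ≠ a := fun e => ht (e ▸ ha)
  unfold rowRank
  rw [if_neg (by rw [Finset.card_pair hta]; omega), if_neg (by rw [Finset.card_pair hta]; omega),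
    if_neg (fun hs => ht (hs (by simp))), if_pos ⟨a, by simp, ha⟩]

/-- `rowRank_pair_KK` (see the file header). -/
theorem rowRank_pair_KK {x y : Fin h} (hxy : x ≠ y) (hx : x ∉ O) (hy : y ∉ O) :
    rowRank w O ({x, y} : Finset (Fin h)) = 6 := by
  unfold rowRank
  rw [if_neg (by rw [Finset.card_pair hxy]; omega), if_neg (by rw [Finset.card_pair hxy]; omega),
    if_neg (fun hs => hx (hs (by simp))), if_neg]
  rintro ⟨c, hc, hcO⟩
  rw [Finset.mem_insert, Finset.mem_singleton] at hc
  rcases hc with rfl | rfl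
  · exact hx hcO
  · exact hy hcO

/-! ## 3. The pivot bijection -/

/-- The pivot face of column `k`: the column itself if it is thin, the matched non-edge if it is a 3-column. -/
def pivFace (k : Fin r) : Finset (Fin h) :=
  if hk : (w k).card = 3 then {α ⟨k, hk⟩, β ⟨k, hk⟩} else w k

variable (hw3 : ∀ k, (w k).card ≤ 3)

include hw3 in
/-- `pivFace_card_le` (see the file header). -/
theorem pivFace_card_le (k : Fin r) : (pivFace w α β k).card ≤ 2 := by
  unfold pivFace
  split_ifs with hk
  · exact Finset.card_insert_le _ _ |>.trans (by simp)
  · have := hw3 k; omega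

variable (hucov : ∀ U : Finset (Fin h), U.card ≤ 2 → ∃ i, u i = U)

include hw3 in
/-- The pivot row of column `k` (the row index of its pivot face). -/
def pivRow (k : Fin r) : Fin r := Classical.choose (hucov (pivFace w α β k) (pivFace_card_le w α β hw3 k))

include hw3 in
/-- `u_pivRow` (see the file header). -/
theorem u_pivRow (k : Fin r) : u (pivRow w α β u hw3 hucov k) = pivFace w α β k :=
  Classical.choose_spec (hucov (pivFace w α β k) (pivFace_card_le w α β hw3 k))

variable (hw : Function.Injective w) (hu : Function.Injective u)
  (hne : ∀ j : {j : Fin r // (w j).card = 3}, ∀ k, w k ≠ {α j, β j})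
  (hinjE : ∀ j j' : {j : Fin r // (w j).card = 3}, ({α j, β j} : Finset (Fin h)) = {α j', β j'} → j = j')

include hw hne hinjE in
/-- `pivRow_injective` (see the file header). -/
theorem pivRow_injective : Function.Injective (pivRow w α β u hw3 hucov) := by
  intro k k' e
  have e' : pivFace w α β k = pivFace w α β k' := by
    rw [← u_pivRow w α β u hw3 hucov k, ← u_pivRow w α β u hw3 hucov k', e]
  unfold pivFace at e'
  by_cases hk : (w k).card = 3 <;> by_cases hk' : (w k').card = 3
  · rw [dif_pos hk, dif_pos hk'] at e'
    exact congrArg Subtype.val (hinjE ⟨k, hk⟩ ⟨k', hk'⟩ e')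
  · rw [dif_pos hk, dif_neg hk'] at e'
    exact absurd e'.symm (hne ⟨k, hk⟩ k')
  · rw [dif_neg hk, dif_pos hk'] at e'
    exact absurd e' (hne ⟨k', hk'⟩ k)
  · rw [dif_neg hk, dif_neg hk'] at e'
    exact hw e'

include hw hne hinjE in
/-- The pivot bijection `σ : columns → rows`. -/
def pivEquiv : Equiv.Perm (Fin r) :=
  Equiv.ofBijective (pivRow w α β u hw3 hucov) (Finite.injective_iff_bijective.mp (pivRow_injective w α β u hw3 hucov hw hne hinjE))

include hw hne hinjE in
/-- `u_pivEquiv` (see the file header). -/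
theorem u_pivEquiv (k : Fin r) : u (pivEquiv w α β u hw3 hucov hw hne hinjE k) = pivFace w α β k :=
  u_pivRow w α β u hw3 hucov k

/-! ## 4. Pair rows: matched / unmatched -/

/-- `eq_pair_of_erase` (see the file header). -/
theorem eq_pair_of_erase {W : Finset (Fin h)} {x y : Fin h} (hy : y ∈ W) (he : W.erase y = {x}) : W = {x, y} := by
  rw [← Finset.insert_erase hy, he, Finset.pair_comm]

include hinjE in
/-- The matching filter of a matched pair is a singleton. -/
theorem filter_match_eq (j : {j : Fin r // (w j).card = 3}) (U : Finset (Fin h))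
    (hj : ({α j, β j} : Finset (Fin h)) = U) :
    Finset.univ.filter (fun j' : {j : Fin r // (w j).card = 3} => ({α j', β j'} : Finset (Fin h)) = U) = {j} := by
  ext j'
  rw [Finset.mem_filter, Finset.mem_singleton]
  constructor
  · rintro ⟨-, hj'⟩; exact hinjE j' j (hj'.trans hj.symm)
  · rintro rfl; exact ⟨Finset.mem_univ _, hj⟩

/-- The matching filter of an unmatched pair is empty. -/
theorem filter_match_empty (U : Finset (Fin h))
    (hun : ∀ j : {j : Fin r // (w j).card = 3}, ({α j, β j} : Finset (Fin h)) ≠ U) :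
    Finset.univ.filter (fun j' : {j : Fin r // (w j).card = 3} => ({α j', β j'} : Finset (Fin h)) = U) = ∅ :=
  Finset.filter_eq_empty_iff.mpr fun j _ => hun j

/-- Unmatched pair rows: `pPoly {x,y} = rr x · rr y`. -/
theorem pPoly_pair_unmatched (x y : Fin h) (hxy : x ≠ y)
    (hun : ∀ j : {j : Fin r // (w j).card = 3}, ({α j, β j} : Finset (Fin h)) ≠ {x, y}) :
    pPoly w α β {x, y} = rr w α β x * rr w α β y := by
  rw [pPoly_pair w α β x y hxy, filter_match_empty w α β _ hun, Finset.sum_empty, add_zero]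

/-- If `{α j, β j} = {x, y}` then `rr x · rr y = rr (α j) · rr (β j)`. -/
theorem rr_mul_rr_of_pair_eq (j : {j : Fin r // (w j).card = 3}) (x y : Fin h) (hxy : x ≠ y)
    (hj : ({α j, β j} : Finset (Fin h)) = {x, y}) :
    rr w α β x * rr w α β y = rr w α β (α j) * rr w α β (β j) := by
  have h1 : α j ∈ ({x, y} : Finset (Fin h)) := by rw [← hj]; simp
  have h2 : β j ∈ ({x, y} : Finset (Fin h)) := by rw [← hj]; simp
  have h3 : y ∈ ({α j, β j} : Finset (Fin h)) := by rw [hj]; simp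
  have h4 : x ∈ ({α j, β j} : Finset (Fin h)) := by rw [hj]; simp
  rw [Finset.mem_insert, Finset.mem_singleton] at h1 h2 h3 h4
  rcases h1 with ha | ha <;> rcases h2 with hb | hb
  · exfalso
    rcases h3 with hc | hc
    · exact hxy (hc.trans ha).symm
    · exact hxy (hc.trans hb).symm
  · rw [ha, hb]
  · rw [ha, hb, mul_comm]
  · exfalso
    rcases h4 with hc | hc
    · exact hxy (hc.trans ha)
    · exact hxy (hc.trans hb)

include hinjE in
/-- Matched pair rows: `pPoly {x, y} = rr (α j) · rr (β j) + corrNE j` when `{α j, β j} = {x, y}`. -/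
theorem pPoly_pair_matched (j : {j : Fin r // (w j).card = 3}) (x y : Fin h) (hxy : x ≠ y)
    (hj : ({α j, β j} : Finset (Fin h)) = {x, y}) :
    pPoly w α β {x, y} = rr w α β (α j) * rr w α β (β j) + corrNE w α β j := by
  rw [pPoly_pair w α β x y hxy, filter_match_eq w α β hinjE j _ hj, Finset.sum_singleton,
    rr_mul_rr_of_pair_eq w α β j x y hxy hj]

/-! ## 5. Diagonal (pivot) entries -/

variable (hα : ∀ j, α j ∈ O) (hβ : ∀ j, β j ∈ O) (hαβ : ∀ j, α j ≠ β j)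
  (hK : ∀ j : {j : Fin r // (w j).card = 3}, ∀ c ∈ w j.1, c ∉ O)

include hw hne hinjE hα hβ hαβ hK in
/-- **Pivots are nonzero.** -/
theorem pMat_diag (k : Fin r) :
    coeff (∑ a' ∈ (∅ : Finset (Fin h)), Finsupp.single (Fin.castAdd h a') 1 +
        ∑ c ∈ w k, Finsupp.single (Fin.natAdd h c) 1)
      (pPoly w α β (u (pivEquiv w α β u hw3 hucov hw hne hinjE k))) ≠ 0 := by
  rw [u_pivEquiv w α β u hw3 hucov hw hne hinjE k]
  unfold pivFace
  by_cases hk : (w k).card = 3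
  · rw [dif_pos hk, pPoly_pair_matched w α β hinjE ⟨k, hk⟩ _ _ (hαβ ⟨k, hk⟩) rfl,
      show w k = w (⟨k, hk⟩ : {j : Fin r // (w j).card = 3}).1 from rfl,
      coeff_pNE_triple w O α β hα hβ hK hw ⟨k, hk⟩ ⟨k, hk⟩, if_pos rfl]
    norm_num
  · rw [dif_neg hk]
    rcases thin_cases (w k) (by have := hw3 k; omega) with h0 | ⟨c, hc⟩ | ⟨x, y, hxy, hxy'⟩
    · rw [h0, pPoly_empty, coeff_one, if_pos]
      · exact one_ne_zero
      · simp
    · rw [hc, pPoly_singleton, coeff_rr_self w O α β hα hβ hK c]; norm_num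
    · rw [hxy', pPoly_pair_unmatched w α β x y hxy (fun j e => hne j k (by rw [hxy', e])),
        coeff_rr_mul_rr_self w O α β hα hβ hK x y hxy]
      exact one_ne_zero

include hα hβ hK in
/-- An unmatched-type pair row with an element outside `O` vanishes at a mixed column `{t', a'}` other than itself. -/
theorem coeff_rr_mul_rr_mixed_eq_zero (x y t' a' : Fin h) (ht' : t' ∉ O) (ha' : a' ∈ O)
    (hnotboth : ¬ (x ∈ O ∧ y ∈ O)) (hneW : ({x, y} : Finset (Fin h)) ≠ {t', a'}) :
    coeff (∑ c ∈ (∅ : Finset (Fin h)), Finsupp.single (Fin.castAdd h c) 1 +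
        ∑ c ∈ ({t', a'} : Finset (Fin h)), Finsupp.single (Fin.natAdd h c) 1) (rr w α β x * rr w α β y) = 0 := by
  have hta : t' ≠ a' := fun e => ht' (e ▸ ha')
  rw [coeff_rr_mul_rr_mixed w O α β hK x y t' a' hta ha']
  by_cases hxO : x ∈ O <;> by_cases hyO : y ∈ O
  · exact absurd ⟨hxO, hyO⟩ hnotboth
  · -- `x ∈ O`, `y ∉ O`
    rw [if_neg (show ¬ t' = x from fun e => ht' (by rw [e]; exact hxO)),
      if_neg (show ¬ a' = y from fun e => hyO (by rw [← e]; exact ha')),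
      inc_eq_zero_of_not_mem w O α β hα hβ hyO]
    by_cases hax : a' = x
    · by_cases hty : t' = y
      · exact absurd (by rw [← hax, ← hty, Finset.pair_comm]) hneW
      · rw [if_neg hty]; simp
    · rw [if_neg hax]; simp
  · -- `x ∉ O`, `y ∈ O`
    rw [if_neg (show ¬ a' = x from fun e => hxO (by rw [← e]; exact ha')),
      inc_eq_zero_of_not_mem w O α β hα hβ hxO {t'}]
    by_cases htx : t' = x
    · by_cases hay : a' = y
      · exact absurd (by rw [← htx, ← hay]) hneW
      · rw [if_neg hay]; simp
    · rw [if_neg htx]; simp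
  · rw [if_neg (show ¬ a' = x from fun e => hxO (by rw [← e]; exact ha')),
      if_neg (show ¬ a' = y from fun e => hyO (by rw [← e]; exact ha'))]
    simp

end Assembly

end

end Summit.ValiantsHypothesis.ValiantsHypothesis.Theorems.BarrierLever.ChowStarvedDesign
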